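import Literature.AlgebraicGeometry.AbelianSchemes.SymplecticLiftsDifferByPrincipalLevelOne
import Literature.AlgebraicGeometry.AbelianSchemes.LevelStructureTwistLocallyConstant
import HarnessLib

/-!
# Two symplectic-liftable level structures differ by a LOCALLY CONSTANT element of `K_δ(1) = GSp_δ(ẑ)`
# (refinements of one structure: of `K_δ(N₀)`) — [MFK94] Ch. 7 §3 pp. 139–140; [Deligne 1971] 4.12 (b), 4.16

Topic `AlgebraicGeometry/AbelianSchemes`; namespace `Literature.AlgebraicGeometry.AbelianSchemes.AbelianSchemeOver.LevelStructure`.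
THEOREMS ONLY (no definition, no named fact, no instance, no notation, no `sorry`; net Literature debt 0).  Cell
hodgecm-mathlib (D-0151), F-DAG leaf F-10 (b) «`classify` for the quotient `M/Γ`», brick (b1‴): the synthesis of ★ (b1)
`LevelStructureTwistLocallyConstant` (two level-`N` structures differ by a LOCALLY CONSTANT `γ̄ ∈ GL_{2g}(ℤ/N)`: clopen
loci `{η₂ = η₁·γ̄}` covering `S`) with ★ (b1′) `SymplecticLiftsDifferByPrincipalLevelOne` (at a geometric point two
SYMPLECTIC-LIFTABLE structures for one polarisation differ by the reduction of some `γ ∈ K_δ(1)`): the matrices of the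
cover can be taken to be reductions `γ̄_j` of elements `γ_j ∈ K_δ(1)` — and of `K_δ(N₀)` when `η₁, η₂` refine the same
level-`N₀` structure.  This is the member-by-member input of the descent step (b2) ([MumfordFogartyKirwan1994] Ch. 7 §3
pp. 139–142): on the kernel pair of a refining cover the two classifying maps to `A_{g,δ,N}` differ by the operators
`T_{γ̄_j}` (★ `SiegelFineModuliScheme.classifyingMap_comp_classifyingMap_twist`, liftability of the twisted universal
structure by ★ `isSymplecticLiftable_twist_of_mem_principalLevelSubgroup_one` — whose `(Γ, hΓ)` currency is the one used
here), and `γ_j ∈ K_δ(N₀)` makes them agree after `A_{g,δ,N} → A_{g,δ,N}/K_δ(N₀)`.  HC_CM is proved only modulo the 7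
printed citations until rung 0 closes; this file discharges none of them (count-neutral capital).

SETTING.  `A/S` a COMMUTATIVE abelian scheme (`[IsCommMonObj A.X]`), `N ≠ 0`, a polarisation `pol : A.Polarization D`,
a type `δ`, `η₁ η₂ : LevelStructure g N A` both symplectic-liftable for `pol` and `δ` (★ D3 `IsSymplecticLiftable`); for
the covers `N` is invertible on `S` (`hN : ∀ t, (N : κ(t)) ≠ 0`, the hypothesis of ★ (b1)).  Elements of `K_δ(1)` are
named `r`, their reductions `GN`/`gm` (entries `integralAdeleResidue N`, ★ `IntegralAdeleResidue`).

* §1 `exists_mem_principalLevelSubgroup_one_restrict_σ_eq_twist_of_isSymplecticLiftable` — AT A GEOMETRIC POINT `s`: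
  `η₂.σᵢ(s) = (η₁·γ̄_N).σᵢ(s)` for some `γ ∈ K_δ(1)` (ample witness ★ `Polarization.exists_ample`, lifts by liftability,
  ★ (b1′)); `exists_mem_principalLevelSubgroup_restrict_σ_eq_twist_of_changeLevel_eq` — for refinements of one
  level-`N₀` structure, `γ ∈ K_δ(N₀)` (★ `map_eq_one_of_changeLevel_eq_of_restrict_σ_eq` + ★
  `mem_principalLevelSubgroup_iff_forall_integralAdeleResidue_eq`).
* §2 **`exists_openCover_comp_left_eq_twist_of_isSymplecticLiftable`**, **`exists_openCover_comp_left_eq_twist_of_changeLevel_eq`**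
  — the OPEN COVER `𝒰` of `S` with `γ_j ∈ K_δ(1)` (resp. `K_δ(N₀)`), reductions `γ̄_j`, and
  `𝒰.f j ≫ η₂.σᵢ = 𝒰.f j ≫ (η₁·γ̄_j).σᵢ` (clopen loci of ★ `exists_isClopen_forall_comp_left_eq_twist_iff` indexed by the
  admissible `γ`, covering `S` by §1 at the geometric point over each `t`; Mathlib `Scheme.openCoverOfIsOpenCover`).

Mathlib searched (pin): `Scheme.openCoverOfIsOpenCover`, `Scheme.fromSpecResidueField_apply`, `AlgebraicClosure`,
`Matrix.GeneralLinearGroup.map_apply` (all used).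

## References
* D. Mumford, J. Fogarty, F. Kirwan, *Geometric Invariant Theory*, 3rd ed. (1994), Ch. 7 §3 (pp. 139–140). [MumfordFogartyKirwan1994]
* P. Deligne, *Travaux de Shimura*, Sém. Bourbaki 389 (1971), 4.12 (b) p. 149; Exemple 4.16 p. 150. [Deligne1971TravauxShimura]
* K.-W. Lan, *Arithmetic compactifications of PEL-type Shimura varieties* (2013), §1.3.6 Lemma 1.3.6.5 (p. 81).
  [Lan2013PELCompactifications]
-/

noncomputable section

universe u

open CategoryTheory Limits AlgebraicGeometry MonoidalCategory NumberField IsDedekindDomain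
open scoped MonObj Matrix

namespace Literature.AlgebraicGeometry.AbelianSchemes.AbelianSchemeOver.LevelStructure

open Literature.AlgebraicGeometry.Motives Literature.AlgebraicGeometry.ModuliOfAbelianVarieties
open Literature.NumberTheory.Adeles NumberField IsDedekindDomain

variable {S : Scheme.{u}} {A : AbelianSchemeOver S} [IsCommMonObj A.X] {g N : ℕ} [NeZero N]
  {D : A.DualPair} {pol : A.Polarization D} {δ : Fin g → ℕ} (η₁ η₂ : LevelStructure g N A)

/-! ### §1 At a geometric point: `η₂(s) = (η₁·γ̄)(s)` with `γ ∈ K_δ(1)`, resp. `γ ∈ K_δ(N₀)` for refinements -/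

/-- **TWO SYMPLECTIC-LIFTABLE LEVEL STRUCTURES FOR ONE POLARISATION DIFFER AT EACH GEOMETRIC POINT BY THE TWIST BY AN
ELEMENT OF `K_δ(1) = GSp_δ(ẑ)`**: at `s : Spec Ω → S` (`Ω` algebraically closed) pick an ample witness `Θ` of the
polarisation (★ `Polarization.exists_ample`), symplectic lifts `Λ₁, Λ₂` of `η₁, η₂` for `Θ` (liftability), and apply ★
`SymplecticLift.exists_mem_principalLevelSubgroup_one_restrict_σ_eq_twist`: `η₂.σᵢ(s) = (η₁·γ̄_N).σᵢ(s)` for the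
reduction `γ̄_N` (entries `integralAdeleResidue N`) of some `γ ∈ K_δ(1)`. [cite: Deligne1971TravauxShimura, 4.12 (b) p. 149]
[cite: Lan2013PELCompactifications, §1.3.6 Lemma 1.3.6.5 (p. 81)] [cite: MumfordFogartyKirwan1994, Ch. 7 §3 (p. 139)] -/
theorem exists_mem_principalLevelSubgroup_one_restrict_σ_eq_twist_of_isSymplecticLiftable
    (h₁ : η₁.IsSymplecticLiftable pol δ) (h₂ : η₂.IsSymplecticLiftable pol δ)
    {Ω : Type u} [Field Ω] [IsAlgClosed Ω] (s : Spec (.of Ω) ⟶ S) :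
    ∃ r : gspFinAdelic δ, r ∈ principalLevelSubgroup δ 1 ∧
      ∀ GN : GL (Fin g ⊕ Fin g) (ZMod N),
        (∀ (i j : Fin g ⊕ Fin g)
          (h : ((r : GL (Fin g ⊕ Fin g) finAdeleQ) : Matrix (Fin g ⊕ Fin g) (Fin g ⊕ Fin g) finAdeleQ) i j ∈
            FiniteAdeleRing.integralAdeles (𝓞 ℚ) ℚ),
          (GN : Matrix (Fin g ⊕ Fin g) (Fin g ⊕ Fin g) (ZMod N)) i j = integralAdeleResidue N ⟨_, h⟩) →
        ∀ i, A.restrict s (η₂.σ i) = A.restrict s ((η₁.twist GN).σ i) := by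
  obtain ⟨Θ, hΘ, hlam⟩ := pol.exists_ample Ω s
  obtain ⟨Λ₁⟩ := h₁.nonempty s hΘ hlam
  obtain ⟨Λ₂⟩ := h₂.nonempty s hΘ hlam
  exact Λ₁.exists_mem_principalLevelSubgroup_one_restrict_σ_eq_twist Λ₂

/-- **TWO SYMPLECTIC-LIFTABLE REFINEMENTS OF ONE LEVEL-`N₀` STRUCTURE DIFFER AT EACH GEOMETRIC POINT BY THE TWIST BY AN
ELEMENT OF `K_δ(N₀)`**: if `N = N₀ d` and `η₁.changeLevel = η₂.changeLevel`, the `γ ∈ K_δ(1)` of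
`exists_mem_principalLevelSubgroup_one_restrict_σ_eq_twist_of_isSymplecticLiftable` lies in `K_δ(N₀)` — its reduction
`γ̄_N` is `≡ 1 (mod N₀)` by ★ `map_eq_one_of_changeLevel_eq_of_restrict_σ_eq` (freeness of the twisting action), and
`K_δ(N₀) = {γ ∈ K_δ(1) | γ ≡ 1 (mod N₀·ẑ)}` (★ `mem_principalLevelSubgroup_iff_forall_integralAdeleResidue_eq`); this is
[MumfordFogartyKirwan1994] p. 140's `Γ_{N₀}^{(d)}` read in `K_δ(1)`. [cite: MumfordFogartyKirwan1994, Ch. 7 §3 (pp. 139–140)]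
[cite: Deligne1971TravauxShimura, 4.12 (b) p. 149 and Exemple 4.16 p. 150] -/
theorem exists_mem_principalLevelSubgroup_restrict_σ_eq_twist_of_changeLevel_eq {N₀ d : ℕ} [NeZero N₀]
    (hd : N = N₀ * d) (hη : η₁.changeLevel N₀ d hd (NeZero.ne N) = η₂.changeLevel N₀ d hd (NeZero.ne N))
    (h₁ : η₁.IsSymplecticLiftable pol δ) (h₂ : η₂.IsSymplecticLiftable pol δ)
    {Ω : Type u} [Field Ω] [IsAlgClosed Ω] (s : Spec (.of Ω) ⟶ S) :
    ∃ r : gspFinAdelic δ, r ∈ principalLevelSubgroup δ N₀ ∧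
      ∀ GN : GL (Fin g ⊕ Fin g) (ZMod N),
        (∀ (i j : Fin g ⊕ Fin g)
          (h : ((r : GL (Fin g ⊕ Fin g) finAdeleQ) : Matrix (Fin g ⊕ Fin g) (Fin g ⊕ Fin g) finAdeleQ) i j ∈
            FiniteAdeleRing.integralAdeles (𝓞 ℚ) ℚ),
          (GN : Matrix (Fin g ⊕ Fin g) (Fin g ⊕ Fin g) (ZMod N)) i j = integralAdeleResidue N ⟨_, h⟩) →
        ∀ i, A.restrict s (η₂.σ i) = A.restrict s ((η₁.twist GN).σ i) := by
  obtain ⟨r, hr1, hr⟩ :=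
    exists_mem_principalLevelSubgroup_one_restrict_σ_eq_twist_of_isSymplecticLiftable η₁ η₂ h₁ h₂ s
  refine ⟨r, ?_, hr⟩
  -- read the residues of `r` through the reduction homomorphism `K_δ(1) → GL_{2g}(ℤ/N)`
  obtain ⟨φ, hφ, -⟩ := exists_monoidHom_principalLevelSubgroup_one_integralAdeleResidue N δ
  have hGN := hr (φ ⟨r, hr1⟩) (fun i j h => hφ ⟨r, hr1⟩ i j h)
  have hmap := map_eq_one_of_changeLevel_eq_of_restrict_σ_eq η₁ η₂ hd hη (φ ⟨r, hr1⟩) s hGN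
  rw [mem_principalLevelSubgroup_iff_forall_integralAdeleResidue_eq N₀ δ hr1]
  intro i j
  have hint := isIntegral_of_isCongOne_one ((mem_principalLevelSubgroup_iff δ).1 hr1).1 i j
  have h1 := congrArg (fun X : GL (Fin g ⊕ Fin g) (ZMod N₀) => (X : Matrix _ _ (ZMod N₀)) i j) hmap
  simp only [Matrix.GeneralLinearGroup.map_apply, Units.val_one] at h1
  rw [hφ ⟨r, hr1⟩ i j hint, ← RingHom.comp_apply, castHom_comp_integralAdeleResidue] at h1
  exact h1

/-! ### §2 The open cover on which `η₂ = η₁ · γ̄`, `γ ∈ K_δ(1)` (resp. `K_δ(N₀)`) -/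

/-- The engine of §2: clopen loci `{η₂ = η₁·φ(γ)}` (★ `exists_isClopen_forall_comp_left_eq_twist_iff`) indexed by the
`γ ∈ K_δ(1)` with a property `P`, covering `S` as soon as every geometric point admits such a `γ`. [cite: MumfordFogartyKirwan1994, Ch. 7 §3 (pp. 139–140)] -/
private theorem exists_openCover_twist_of_forall_point (hN : ∀ t : S, (N : S.residueField t) ≠ 0)
    (P : gspFinAdelic δ → Prop)
    (hpt : ∀ (Ω : Type u) [Field Ω] [IsAlgClosed Ω] (s : Spec (.of Ω) ⟶ S),
      ∃ r : gspFinAdelic δ, r ∈ principalLevelSubgroup δ 1 ∧ P r ∧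
        ∀ GN : GL (Fin g ⊕ Fin g) (ZMod N),
          (∀ (i j : Fin g ⊕ Fin g)
            (h : ((r : GL (Fin g ⊕ Fin g) finAdeleQ) : Matrix (Fin g ⊕ Fin g) (Fin g ⊕ Fin g) finAdeleQ) i j ∈
              FiniteAdeleRing.integralAdeles (𝓞 ℚ) ℚ),
            (GN : Matrix (Fin g ⊕ Fin g) (Fin g ⊕ Fin g) (ZMod N)) i j = integralAdeleResidue N ⟨_, h⟩) →
          ∀ i, A.restrict s (η₂.σ i) = A.restrict s ((η₁.twist GN).σ i)) :
    ∃ (𝒰 : Scheme.OpenCover.{0} S) (r : 𝒰.I₀ → gspFinAdelic δ) (gm : 𝒰.I₀ → GL (Fin g ⊕ Fin g) (ZMod N)),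
      (∀ j, r j ∈ principalLevelSubgroup δ 1 ∧ P (r j)) ∧
      (∀ j (i i' : Fin g ⊕ Fin g)
        (h : ((r j : GL (Fin g ⊕ Fin g) finAdeleQ) : Matrix (Fin g ⊕ Fin g) (Fin g ⊕ Fin g) finAdeleQ) i i' ∈
          FiniteAdeleRing.integralAdeles (𝓞 ℚ) ℚ),
        (gm j : Matrix (Fin g ⊕ Fin g) (Fin g ⊕ Fin g) (ZMod N)) i i' = integralAdeleResidue N ⟨_, h⟩) ∧
      ∀ j i, 𝒰.f j ≫ (η₂.σ i).left = 𝒰.f j ≫ ((η₁.twist (gm j)).σ i).left := by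
  classical
  obtain ⟨φ, hφ, -⟩ := exists_monoidHom_principalLevelSubgroup_one_integralAdeleResidue N δ
  -- the clopen loci `{η₂ = η₁ · φ γ}`
  have hloc := fun r : principalLevelSubgroup δ 1 => exists_isClopen_forall_comp_left_eq_twist_iff η₁ η₂ hN (φ r)
  choose U hU hiff using hloc
  let J : Type := {r : principalLevelSubgroup δ 1 // P r}
  let V : J → S.Opens := fun j => ⟨U j.1, (hU j.1).isOpen⟩
  have hV : TopologicalSpace.IsOpenCover V := by
    rw [TopologicalSpace.IsOpenCover, eq_top_iff]
    rintro t -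
    -- the geometric point over `t`
    let Ω : Type u := AlgebraicClosure (S.residueField t)
    let sbar : Spec (.of Ω) ⟶ S :=
      Spec.map (CommRingCat.ofHom (algebraMap (S.residueField t) Ω)) ≫ S.fromSpecResidueField t
    obtain ⟨r, hr1, hP, hr⟩ := hpt Ω sbar
    have hsb : ∀ i, sbar ≫ (η₂.σ i).left = sbar ≫ ((η₁.twist (φ ⟨r, hr1⟩)).σ i).left := fun i => by
      have h := congrArg Over.Hom.left (hr (φ ⟨r, hr1⟩) (fun i j h => hφ ⟨r, hr1⟩ i j h) i)
      rw [restrict_left, restrict_left] at h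
      exact h
    have hsub := (hiff ⟨r, hr1⟩ sbar).1 hsb
    have hpt' : sbar.base (IsLocalRing.closedPoint Ω) = t := by
      simp only [sbar, Scheme.Hom.comp_base, TopCat.comp_app]
      exact Scheme.fromSpecResidueField_apply _ _
    exact TopologicalSpace.Opens.mem_iSup.mpr ⟨⟨⟨r, hr1⟩, hP⟩, hpt' ▸ hsub ⟨_, rfl⟩⟩
  refine ⟨S.openCoverOfIsOpenCover V hV, fun j => (j.1 : gspFinAdelic δ), fun j => φ j.1, fun j => ⟨j.1.2, j.2⟩,
    fun j i i' h => hφ j.1 i i' h, fun j i => ?_⟩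
  refine ((hiff j.1 (V j).ι).2 ?_) i
  rw [Scheme.Opens.range_ι]
  exact subset_rfl

/-- **THE OPEN COVER ON WHICH TWO SYMPLECTIC-LIFTABLE LEVEL STRUCTURES DIFFER BY THE TWIST BY AN ELEMENT OF `K_δ(1)`**:
for `η₁, η₂` symplectic-liftable for one polarisation of `A/S` (`N` invertible on `S`) there is an open cover `𝒰` of
`S` with elements `γ_j ∈ K_δ(1)` and their reductions `γ̄_j ∈ GL_{2g}(ℤ/N)` (entries `integralAdeleResidue N`) such that
`η₂.σᵢ = (η₁·γ̄_j).σᵢ` on the `j`-th member — §1 at the geometric points + the clopen loci of ★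
`LevelStructureTwistLocallyConstant` ([MumfordFogartyKirwan1994] p. 140 «`Γ_n` acts on `ℋ_{g,d,n}`» continuously;
[Deligne1971TravauxShimura] 4.12 (b): the classes `k mod K` form one `K`-orbit).
[cite: MumfordFogartyKirwan1994, Ch. 7 §3 (pp. 139–140)] [cite: Deligne1971TravauxShimura, 4.12 (b) p. 149] -/
theorem exists_openCover_comp_left_eq_twist_of_isSymplecticLiftable (hN : ∀ t : S, (N : S.residueField t) ≠ 0)
    (h₁ : η₁.IsSymplecticLiftable pol δ) (h₂ : η₂.IsSymplecticLiftable pol δ) :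
    ∃ (𝒰 : Scheme.OpenCover.{0} S) (r : 𝒰.I₀ → gspFinAdelic δ) (gm : 𝒰.I₀ → GL (Fin g ⊕ Fin g) (ZMod N)),
      (∀ j, r j ∈ principalLevelSubgroup δ 1) ∧
      (∀ j (i i' : Fin g ⊕ Fin g)
        (h : ((r j : GL (Fin g ⊕ Fin g) finAdeleQ) : Matrix (Fin g ⊕ Fin g) (Fin g ⊕ Fin g) finAdeleQ) i i' ∈
          FiniteAdeleRing.integralAdeles (𝓞 ℚ) ℚ),
        (gm j : Matrix (Fin g ⊕ Fin g) (Fin g ⊕ Fin g) (ZMod N)) i i' = integralAdeleResidue N ⟨_, h⟩) ∧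
      ∀ j i, 𝒰.f j ≫ (η₂.σ i).left = 𝒰.f j ≫ ((η₁.twist (gm j)).σ i).left := by
  obtain ⟨𝒰, r, gm, hr, hgm, heq⟩ := exists_openCover_twist_of_forall_point η₁ η₂ hN (fun _ => True)
    fun Ω _ _ s => by
      obtain ⟨r, hr1, hr⟩ :=
        exists_mem_principalLevelSubgroup_one_restrict_σ_eq_twist_of_isSymplecticLiftable η₁ η₂ h₁ h₂ s
      exact ⟨r, hr1, True.intro, hr⟩
  exact ⟨𝒰, r, gm, fun j => (hr j).1, hgm, heq⟩

/-- **THE OPEN COVER ON WHICH TWO SYMPLECTIC-LIFTABLE REFINEMENTS OF ONE LEVEL-`N₀` STRUCTURE DIFFER BY THE TWIST BY AN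
ELEMENT OF `K_δ(N₀)`** (`N = N₀ d`, `η₁.changeLevel = η₂.changeLevel`): as above with `γ_j ∈ K_δ(N₀)` — the input of
the descent step of [MumfordFogartyKirwan1994] Ch. 7 §3 (pp. 139–142) along a refining cover: on the kernel pair the two
refinements are exchanged by the operators `T_{γ̄_j}`, `γ_j ∈ K_δ(N₀)`, member by member.
[cite: MumfordFogartyKirwan1994, Ch. 7 §3 (pp. 139–140)] [cite: Deligne1971TravauxShimura, 4.12 (b) p. 149 and Exemple 4.16 p. 150] -/
theorem exists_openCover_comp_left_eq_twist_of_changeLevel_eq (hN : ∀ t : S, (N : S.residueField t) ≠ 0)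
    {N₀ d : ℕ} [NeZero N₀] (hd : N = N₀ * d)
    (hη : η₁.changeLevel N₀ d hd (NeZero.ne N) = η₂.changeLevel N₀ d hd (NeZero.ne N))
    (h₁ : η₁.IsSymplecticLiftable pol δ) (h₂ : η₂.IsSymplecticLiftable pol δ) :
    ∃ (𝒰 : Scheme.OpenCover.{0} S) (r : 𝒰.I₀ → gspFinAdelic δ) (gm : 𝒰.I₀ → GL (Fin g ⊕ Fin g) (ZMod N)),
      (∀ j, r j ∈ principalLevelSubgroup δ N₀) ∧
      (∀ j (i i' : Fin g ⊕ Fin g)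
        (h : ((r j : GL (Fin g ⊕ Fin g) finAdeleQ) : Matrix (Fin g ⊕ Fin g) (Fin g ⊕ Fin g) finAdeleQ) i i' ∈
          FiniteAdeleRing.integralAdeles (𝓞 ℚ) ℚ),
        (gm j : Matrix (Fin g ⊕ Fin g) (Fin g ⊕ Fin g) (ZMod N)) i i' = integralAdeleResidue N ⟨_, h⟩) ∧
      ∀ j i, 𝒰.f j ≫ (η₂.σ i).left = 𝒰.f j ≫ ((η₁.twist (gm j)).σ i).left := by
  obtain ⟨𝒰, r, gm, hr, hgm, heq⟩ := exists_openCover_twist_of_forall_point η₁ η₂ hN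
    (fun r => r ∈ principalLevelSubgroup δ N₀) fun Ω _ _ s => by
      obtain ⟨r, hrN, hr⟩ :=
        exists_mem_principalLevelSubgroup_restrict_σ_eq_twist_of_changeLevel_eq η₁ η₂ hd hη h₁ h₂ s
      exact ⟨r, principalLevelSubgroup_anti δ (one_dvd N₀) hrN, hrN, hr⟩
  exact ⟨𝒰, r, gm, fun j => (hr j).2, hgm, heq⟩

end Literature.AlgebraicGeometry.AbelianSchemes.AbelianSchemeOver.LevelStructure

end
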